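import Summits.HodgeConjecture.HodgeConjecture.Theses.HeckePrymWeil
import Summits.HodgeConjecture.HodgeConjecture.Theorems.HeckePrymWeilHyperbolicEightfoldsSqrtMinus7OfHyperbolicReach
import HarnessLib.Audit

/-!
# Line `Sketch` — skeleton v11 for crux `HeckePrymWeil.HyperbolicEightfoldsSqrtMinus7`
(item stmt-HodgeConjecture-14642, route route-HodgeConjecture-HeckePrymWeil)

v11 (lead `prover-line-stmt-HodgeConjecture-14642-c9-0`, gen 9, 2026-08-16; prepared by lead c8) = v10 ("hyperbolic
reach", leads c6/c7) CONSOLIDATED: every proved part of v10 is now consumed BY NAME from the landed, sorry-free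
`Theorems/HeckePrymWeilHyperbolicEightfoldsSqrtMinus7OfHyperbolicReach` (p127626) — the unconditional anchor `hypAnchor`
(p127273), the composition `hyperbolicEightfoldsSqrtMinus7_of_hypFamilyFact_of_hypWeilTransport`, the tightness theorem
`hypWeilTransport_of_hyperbolicEightfoldsSqrtMinus7`, the iff `hyperbolicEightfoldsSqrtMinus7_iff_hypWeilTransport` and the
cross-link `hypWeilTransport_of_weilVariationalHodge`.  The two registered stubs are byte-identical to v10:
`stub_hypFamilyFact` (NAMED FACT, by name) and `stub_hypWeilTransport` (HT, OPEN).  Sorries: 2 (= the registered stubs).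

Mechanism (unchanged from v9/v10).  Deligne's polarized Weil family over the HYPERBOLIC component, through the hyperbolic
eightfold `(A, φ, e, a)` of the crux itself (named fact `HodgeTheory.weilFamily_hyperbolic_weilSystem_reach`; Stub HF — this
is where hyperbolicity is consumed), carries the crux's class `c` (upgraded to the strong Weil plane) as a flat,
fibrewise-Hodge Weil section; the REACH clause lands, up to a `K`-linear isogeny FROM a fibre `Y_s`, on the explicit
hyperbolic ANCHOR `hypAnchor` (the eightfold `((E × E)²)²` built from the tensor surface; its strong Weil plane is algebraic,
UNCONDITIONAL, landed); isogeny descent makes the Weil plane of `Y_s` algebraic, hence the section's value at `s`; the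
W-engine globalises the section; the TRANSPORT from `s` back to the base point `s₀` (chart = `A` itself, hyperbolic) is the
open Stub HT = variational Hodge for flat WEIL classes towards a HYPERBOLIC fibre — which the crux itself implies
(`hypWeilTransport_of_crux`, whose proof uses neither the family nor the algebraic fibre), so that, modulo the
construction fact HF, the crux is EQUIVALENT to Stub HT.

Registered stubs v11: `stub_hypFamilyFact` (NAMED FACT, by name), `stub_hypWeilTransport` (HT, OPEN).
`HyperbolicEightfoldsSqrtMinus7_of` concludes the crux BY NAME.
-/

noncomputable section

set_option linter.dupNamespace false

open CategoryTheory MonoidalCategory CartesianMonoidalCategory AlgebraicGeometry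
open Literature.AlgebraicGeometry Literature.AlgebraicGeometry.Motives
  Literature.AlgebraicGeometry.HodgeTheory Literature.AlgebraicTopology.SingularHomology
open Summit.HodgeConjecture.HodgeConjecture.Theorems.HyperbolicEightfoldsSqrtMinus7.HyperbolicReach
  (hypAnchor hyperbolicEightfoldsSqrtMinus7_of_hypFamilyFact_of_hypWeilTransport
    hypWeilTransport_of_hyperbolicEightfoldsSqrtMinus7 hyperbolicEightfoldsSqrtMinus7_at_anchor)

namespace Summit.HodgeConjecture.HodgeConjecture.Cruxes.HyperbolicEightfoldsSqrtMinus7.HyperbolicReach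

/-! ### Stub HF: Deligne's hyperbolic Weil family, BY NAME (named fact, accepted) -/

/-- **Stub HF — the polarized Weil family over the hyperbolic component through a HYPERBOLIC `(P, ψ₀, h_K)`,
its flat Weil sub-local system, and reach of every hyperbolic target up to a `K`-isogeny from a fibre** —
the tree's named fact `HodgeTheory.weilFamily_hyperbolic_weilSystem_reach` BY NAME (Literature debt: the
universal PEL abelian scheme over `Γ\X⁺`; reduced in the tree to bare construction packages,
`WeilFamilyReachOf{Level,Period}Construction`; the route's construction crux is stmt-HodgeConjecture-16866).
[cite: Deligne1982HodgeCycles, proof of Thm. 4.8 (pp. 47–52) with Prop. 4.4]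
[cite: vanGeemen1994HodgeAV, Lemma 5.2, 5.3–5.4 and 5.8–5.11] -/
theorem stub_hypFamilyFact : weilFamily_hyperbolic_weilSystem_reach := by
  sorry

/-! ### Stub HT: Weil transport towards a HYPERBOLIC fibre (OPEN; the crux implies it) -/

/-- **Stub HT — C⁺, variational Hodge for flat WEIL classes towards a HYPERBOLIC fibre, in dimension 8 (OPEN).**
For an embedded smooth projective family of eightfolds `f : 𝒳 ⟶ S` over a smooth irreducible quasi-projective
base and a global class `W ∈ H⁸(𝒳(ℂ); ℂ)` that is, at every fibre, rational of type `(4,4)` and carried by a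
chart `e_s : A_s ≅ 𝒳_s` of a `√-7`-abelian eightfold into the strong Weil plane `weilClassesOf A_s φ_s 4 7`:
if at `s₀` some such chart is HYPERBOLIC in the crux's embedded typing, then `W|_s` algebraic at ONE fibre
`s` forces `W|_{s₀}` algebraic.  Implied by `WeilVariationalHodge (7,4)` (stmt-14497) and by the crux
(`hypWeilTransport_of_crux`): modulo Stub HF the crux is EQUIVALENT to this stub.
[informal size XL; OPEN — = Markman2025SecantWeil Thm 1.5.1 one dimension up, on the hyperbolic component]
[cite: Markman2025SecantWeil, Thm. 1.5.1 and §1.2] [cite: Grothendieck1966, footnote 13] -/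
theorem stub_hypWeilTransport :
    ∀ ⦃𝒳 S : SchemeOver ℂ⦄ (f : 𝒳 ⟶ S), IsSmoothProjectiveFamily f 8 →
      (∃ (N : ℕ) (ι : 𝒳 ⟶ projectiveSpace N ℂ ⊗ S),
          IsClosedImmersion ι.left ∧ ι ≫ snd (projectiveSpace N ℂ) S = f) →
      IrreducibleSpace S.left → AlgebraicGeometry.Smooth S.hom → IsQuasiProjectiveOver S →
      ∀ (W : complexBetti 𝒳 8),
        (∀ s : ComplexPoints S, IsRationalClass (complexBetti.map (fiberι f s) 8 W) ∧
          IsOfHodgeType 8 (fiberOver f s) 8 4 4 (complexBetti.map (fiberι f s) 8 W)) →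
        (∀ s : ComplexPoints S, ∃ (A' : AbelianVariety ℂ) (φ' : A' ⟶ A') (e' : A'.X ≅ fiberOver f s),
          A'.dim = 8 ∧ φ' ≫ φ' = -((7 : ℤ) • 𝟙 A') ∧
          complexBetti.map e'.hom 8 (complexBetti.map (fiberι f s) 8 W) ∈ weilClassesOf A' φ' 4 7) →
        ∀ s₀ : ComplexPoints S,
          (∃ (A : AbelianVariety ℂ) (φ : A ⟶ A) (e₀ : A.X ≅ fiberOver f s₀) (e : ProjectiveEmbedding A.X)
              (a : complexBetti (projectiveSpace e.n ℂ) 2),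
            A.dim = 8 ∧ φ ≫ φ = -((7 : ℤ) • 𝟙 A) ∧ IsRationalClass a ∧ a ≠ 0 ∧
            IsHyperbolicWeilType A φ 4
              ((7 : ℂ) • complexBetti.map e.ι 2 a + complexBetti.map φ.hom.hom.hom 2 (complexBetti.map e.ι 2 a)) ∧
            complexBetti.map e₀.hom 8 (complexBetti.map (fiberι f s₀) 8 W) ∈ weilClassesOf A φ 4 7) →
          (∃ s : ComplexPoints S, complexBetti.map (fiberι f s) 8 W ∈ algebraicClasses (fiberOver f s) 4) →
          complexBetti.map (fiberι f s₀) 8 W ∈ algebraicClasses (fiberOver f s₀) 4 := by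
  sorry

/-! ### The anchor (landed, unconditional) -/

/-- **The anchor is a term of the tree**: an explicit hyperbolic `√-7`-abelian EIGHTFOLD in the crux's embedded typing
whose strong Weil plane is algebraic (`hypAnchor`, p127273: `((E × E)²)²` from the tensor surface, hyperbolic by TS + HP,
algebraic by the tensor-point anchor + isogeny descent). [cite: Deligne1982HodgeCycles, Lemma 4.5]
[cite: vanGeemen1994HodgeAV, 5.2–5.4] -/
theorem hypAnchor_of_stubs :
    ∃ (T : AbelianVariety ℂ) (φT : T ⟶ T) (eT : ProjectiveEmbedding T.X)
      (aT : complexBetti (projectiveSpace eT.n ℂ) 2),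
      T.dim = 8 ∧ φT ≫ φT = -((7 : ℤ) • 𝟙 T) ∧ IsRationalClass aT ∧ aT ≠ 0 ∧
      IsHyperbolicWeilType T φT 4
        ((7 : ℂ) • complexBetti.map eT.ι 2 aT + complexBetti.map φT.hom.hom.hom 2 (complexBetti.map eT.ι 2 aT)) ∧
      weilClassesOf T φT 4 7 ≤ algebraicClasses T.X 4 :=
  hypAnchor

/-! ### The composition (concludes the crux BY NAME) -/

/-- **`HyperbolicEightfoldsSqrtMinus7` from the stubs** — hyperbolicity LOAD-BEARING; the composition is the landed
`hyperbolicEightfoldsSqrtMinus7_of_hypFamilyFact_of_hypWeilTransport` (p127626) applied to Stub HF and Stub HT.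
[cite: Deligne1982HodgeCycles, proof of Thm. 4.8] [cite: vanGeemen1994HodgeAV, 5.2–5.11]
[cite: Markman2025SurveySecant, §11.5 Step 1] -/
theorem HyperbolicEightfoldsSqrtMinus7_of :
    Summit.HodgeConjecture.HodgeConjecture.Theses.HeckePrymWeil.HyperbolicEightfoldsSqrtMinus7 :=
  hyperbolicEightfoldsSqrtMinus7_of_hypFamilyFact_of_hypWeilTransport stub_hypFamilyFact stub_hypWeilTransport

/-! ### Tightness: the crux implies Stub HT (so, modulo HF, crux ⟺ HT) — landed -/

/-- **The crux implies the hyperbolic Weil transport (Stub HT)** — the landed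
`hypWeilTransport_of_hyperbolicEightfoldsSqrtMinus7`: at the hyperbolic chart of `s₀` the crux applies outright; neither the
family nor the algebraic fibre is used. [cite: vanGeemen1994HodgeAV, 4.9] -/
theorem hypWeilTransport_of_crux
    (h : Summit.HodgeConjecture.HodgeConjecture.Theses.HeckePrymWeil.HyperbolicEightfoldsSqrtMinus7) :
    type_of% stub_hypWeilTransport :=
  hypWeilTransport_of_hyperbolicEightfoldsSqrtMinus7 h

/-- **Modulo Stub HF the crux is EQUIVALENT to Stub HT.** [cite: Markman2025SecantWeil, Thm. 1.5.1 and §1.2] -/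
theorem crux_iff_hypWeilTransport (hHF : weilFamily_hyperbolic_weilSystem_reach) :
    Summit.HodgeConjecture.HodgeConjecture.Theses.HeckePrymWeil.HyperbolicEightfoldsSqrtMinus7 ↔
      type_of% stub_hypWeilTransport :=
  ⟨hypWeilTransport_of_hyperbolicEightfoldsSqrtMinus7,
    hyperbolicEightfoldsSqrtMinus7_of_hypFamilyFact_of_hypWeilTransport hHF⟩

/-! ### Cross-link: Stub HT from the route crux `WeilVariationalHodge` (stmt-14497) — landed -/

/-- **Stub HT is implied by `WeilVariationalHodge (7,4)`** (forget the embedding, Weil and hyperbolic clauses).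
[cite: Grothendieck1966, footnote 13] -/
theorem hypWeilTransport_of_weilVariationalHodge
    (hV : Summit.HodgeConjecture.HodgeConjecture.Theses.HeckePrymWeil.WeilVariationalHodge) :
    type_of% stub_hypWeilTransport :=
  Summit.HodgeConjecture.HodgeConjecture.Theorems.HyperbolicEightfoldsSqrtMinus7.HyperbolicReach.hypWeilTransport_of_weilVariationalHodge
    hV

/-! ### The crux at the anchor (landed, unconditional instance) -/

/-- **The crux's hypotheses are jointly satisfiable and its conclusion holds on the anchor** (landed
`hyperbolicEightfoldsSqrtMinus7_at_anchor`). [cite: Deligne1982HodgeCycles, Lemma 4.5] -/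
theorem crux_at_anchor :
    ∃ (T : AbelianVariety ℂ) (φT : T ⟶ T) (eT : ProjectiveEmbedding T.X)
      (aT : complexBetti (projectiveSpace eT.n ℂ) 2),
      T.dim = 8 ∧ φT ≫ φT = -((7 : ℤ) • 𝟙 T) ∧ IsRationalClass aT ∧ aT ≠ 0 ∧
      IsHyperbolicWeilType T φT 4
        ((7 : ℂ) • complexBetti.map eT.ι 2 aT + complexBetti.map φT.hom.hom.hom 2 (complexBetti.map eT.ι 2 aT)) ∧
      ∀ c : complexBetti T.X 8,
        c ∈ Module.End.eigenspace (complexBetti.map (𝟙 T + φT).hom.hom.hom 8).hom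
              ((1 + Complex.I * (Real.sqrt (7 : ℝ) : ℂ)) ^ 8) ⊔
            Module.End.eigenspace (complexBetti.map (𝟙 T + φT).hom.hom.hom 8).hom
              ((1 - Complex.I * (Real.sqrt (7 : ℝ) : ℂ)) ^ 8) →
        c ∈ algebraicClasses T.X 4 :=
  hyperbolicEightfoldsSqrtMinus7_at_anchor

end Summit.HodgeConjecture.HodgeConjecture.Cruxes.HyperbolicEightfoldsSqrtMinus7.HyperbolicReach

end
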